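import Literature.NumberTheory.EllipticCurves.SkinnerUrban2014.CofinitelyGeneratedSelmer
import Literature.NumberTheory.EllipticCurves.SkinnerUrban2014.CofinitelyGeneratedSelmerNewform
import Literature.NumberTheory.EllipticCurves.SelmerCocycleLiftUnramifiedFiniteProofs
import Literature.NumberTheory.EllipticCurves.BigRepModuleShiftStructureProofs
import Literature.NumberTheory.EllipticCurves.BigGaloisRepLocalInputs
import Literature.NumberTheory.EllipticCurves.IwasawaAlgebraCompactNakayamaProofs
import Literature.NumberTheory.EllipticCurves.PadicIntSeparatedFiniteProofs
import Literature.NumberTheory.IwasawaTheory.Greenberg2006.TwistDeformation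
import HarnessLib

/-!
# Proof of Skinner–Urban 2014 Lemma 3.1.9 (after Greenberg) for `A = Λ = ℤ_p⟦T⟧`:
# `X^Σ = Sel^Σ_𝔮(K, T ⊗ Λ^*)^∨` is a finitely generated `Λ`-module —
# discharge of `SkinnerUrban2014.lemma319_finite_XBig`

`Proofs` file (theorems only: no definition, no named fact, no instance; D-0026), sibling of
`CofinitelyGeneratedSelmer.lean`, whose named fact it discharges
(**`lemma319_finite_XBig_holds`**, at the end). Cell `bsd-stepL` (typer lane); plan of record
`pub/bsd-cited/sheets/NOTE-r17-FG-lemma319-discharge-plan.md` (868cb889; F1 =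
`BigRepModuleShiftStructureProofs` by bsd-cited r17, F2 = `SelmerCocycleLiftUnramifiedFiniteProofs`,
F3 = this file), with one design change: everything is done at COCYCLE level (no second lift, the
hypothesis "`A₀` is `p`-divisible" of the fact is not needed).

## The printed argument ([SU14] p. 20: "See the proposition in Section 4 of [Gr94] where it is essentially deduced from the arguments used to prove Proposition 3.2.8"; [GreenbergLNM1716] §4, Props. 4.9–4.10; [Cas18] Def. 2.2 "easily shown to be a finitely generated Λ-module")

`X = Sel^∨` is a compact `Λ`-module; by the topological Nakayama lemma it is finitely generated as
soon as `X/𝔪X` is finite, `𝔪 = (p, T)`, and `X/𝔪X` is dual to `Sel[𝔪]`, which is controlled by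
`H¹(G_{K,S}, M[𝔪])`, finite by Hermite–Minkowski.

## The proof given here (run on the tree's objects, `M = BigRepModule ℤ_p p A₀` with `bigRep`)

Write `Sel = selmerBig κ ρ 𝔮 Σ ⊆ H¹ = H¹(Γ_K, M)`, `X = XBig κ ρ 𝔮 Σ = Hom(Sel, ℚ/ℤ)`, `Λ = ℤ_p⟦T⟧`
acting on `M` through `T ↦ τ₁ − 1` and on `X` by precomposition. The tree's compact Nakayama in
separated form (`module_finite_of_separated_of_forall_exists_sub_X_smul_mem_span`, [Washington1997]
Lemma 13.16) asks for:
* (N1) `X` is `(p, T)`-SEPARATED. Every class of `H¹` is killed by `Tⁿ` and `pⁿ` for some `n`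
  (`Γ_K` compact, `M` discrete and `(p, T)`-primary: `BigGaloisRep.exists_pow_smul_eq_zero_and` with
  `BigRepModule.exists_X_pow_smul_eq_zero`, `exists_C_natCast_pow_smul_eq_zero`), so
  `x = Tⁿ y + pⁿ z` vanishes on every `c ∈ Sel`.
* (N2) `X = ⟨s⟩_Λ + T·X` for a finite `s`. (a) A character of `Sel` killing `Sel[T]` is `T·ψ`
  (factor through `Sel/Sel[T] ≅ T·Sel ↪ Sel` and extend, `ℚ/ℤ` injective:
  `exists_smul_eq_of_forall_apply_eq_zero`). (b) `Sel[T]` is reached by COCYCLES OF `A₀`: a class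
  `c ∈ Sel` with `T c = 0` is `[z]` with `T z = 0` pointwise (LIFT
  `exists_oneCocycleClass_eq_forall_smul_apply_eq_zero`, `T` onto `M` by
  `BigRepModule.shiftSubOne_surjective`), the values of `z` are CONSTANT functions
  (`BigRepModule.X_smul_eq_zero_iff`), i.e. `z = ι ∘ φ` for a continuous cocycle `φ : Γ_K → A₀`
  (`ι a =` the constant function `a`, equivariant by `bigRep_mk_const`), and `φ` VANISHES on the
  inertia group `localMap K (Sum.inr w)` of every `w ∉ Σ`, `w ∤ p` (the class dies there and `I_w`
  acts trivially on `M`: `apply_eq_zero_of_resH1_eq_zero`, `ZpExtension.apply_localMap_inr`, `hunr`).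
  (c) Let `U` be the `ℤ_p`-module of continuous cocycles `φ : Γ_K → A₀` vanishing on those inertia
  groups and with `[ι ∘ φ] ∈ Sel`, and `π : U → Sel`, `φ ↦ [ι ∘ φ]` (additive, `a ↦ C a`-semilinear).
  The Pontryagin dual `U^∨` is a finitely generated `ℤ_p`-module
  (`module_finite_characterModule_of_torsion_finite`: `U` is `p`-primary with FINITE `p`-torsion —
  the `p`-torsion cocycles take values in `A₀[p]` and vanish on inertia outside `Σ ∪ S_p`,
  `finite_setOf_contOneCocycles_smul_eq_zero_vanishing_inertia`, Silverman X.4.3 — and the tree's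
  `ℤ_p`-Nakayama `PadicIntSeparatedFiniteProofs` applies with `F = (U[p])^∨`); hence so is its
  submodule `W = {x ∘ π | x ∈ X}` (`ℤ_p` noetherian). (d) If
  `x₁, …, xₙ ∈ X` map to generators of `W`, then for `x ∈ X` some `x − Σ aᵢ xᵢ` kills `π(U) ⊇ Sel[T]`,
  so lies in `T·X` by (a): `s = {xᵢ}`.

References: [SkinnerUrban2014] §3.1.3 (p. 18), Lemma 3.1.9 (p. 20); [GreenbergLNM1716] §4
(Props. 4.9–4.10 and the proposition cited by [SU14]); [Castella2018] Def. 2.2 (p. 4);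
[Washington1997] Lemma 13.16; [SerreGaloisCohomology1997] I §2.2, §5.1; [SilvermanAEC2009] X.4.3.
-/

noncomputable section

open Field IsDedekindDomain NumberField
open Literature.NumberTheory.EllipticCurves Literature.NumberTheory.EllipticCurves.BigGaloisRep
open Literature.NumberTheory.GaloisRepresentations

namespace Literature.NumberTheory.EllipticCurves.SkinnerUrban2014

/-! ### §1. Pontryagin-dual algebra -/

section Dual

/-- The character group of a finite abelian group is finite (characters take values in the
`#B`-torsion of `ℚ/ℤ`, a finite set). [cite: Washington1997, Lemma 13.16 (Pontryagin duals of finite modules, used in the proof)] -/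
theorem finite_characterModule (B : Type*) [AddCommGroup B] [Finite B] :
    Finite (CharacterModule B) := by
  classical
  have hN : 0 < Nat.card B := Nat.card_pos
  have hT : {u : AddCircle (1 : ℚ) | Nat.card B • u = 0}.Finite := AddCircle.finite_torsion (1 : ℚ) hN
  haveI := hT.to_subtype
  refine Finite.of_injective (fun χ : CharacterModule B => fun b : B =>
    (⟨χ b, by rw [Set.mem_setOf_eq, ← map_nsmul, card_nsmul_eq_zero', map_zero]⟩ :
      {u : AddCircle (1 : ℚ) | Nat.card B • u = 0})) fun χ χ' h => ?_
  ext b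
  exact congrArg Subtype.val (congrFun h b)

variable {R : Type*} [CommRing R] {N : Type*} [AddCommGroup N] [Module R N]

/-- **Factor and extend**: a character of `N` that kills the `r`-torsion `N[r]` is an `r`-multiple,
`χ = r·ψ` (`χ` factors through `N/N[r] ≅ r·N ↪ N` and extends to `N` because `ℚ/ℤ` is divisible,
`CharacterModule.dual_surjective_of_injective`). With `r = T` on `Sel`: `Hom(Sel/Sel[T], ℚ/ℤ)ᵒ…`,
i.e. `X/TX ↪ Sel[T]^∨`. [cite: Washington1997, Lemma 13.16 (X/TX for the Pontryagin dual X)]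
[cite: GreenbergLNM1716, §4, proof of Prop. 4.10 (dualising 0 → 𝒜[θ] → 𝒜 →θ 𝒜 → 0)] -/
theorem exists_smul_eq_of_forall_apply_eq_zero (r : R) (χ : CharacterModule N)
    (hχ : ∀ n : N, r • n = 0 → χ n = 0) : ∃ ψ : CharacterModule N, r • ψ = χ := by
  classical
  have key : ∀ n₁ n₂ : N, r • n₁ = r • n₂ → χ n₁ = χ n₂ := fun n₁ n₂ h => by
    rw [← sub_eq_zero, ← map_sub]
    exact hχ _ (by rw [smul_sub, h, sub_self])
  let τ : N →ₗ[R] N := DistribSMul.toLinearMap R N r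
  have hτ : ∀ n, τ n = r • n := fun _ => rfl
  choose c hc using fun y : LinearMap.range τ => LinearMap.mem_range.1 y.2
  have hc' : ∀ y : LinearMap.range τ, r • c y = (y : N) := fun y => by rw [← hτ, hc]
  let ψ₀ : CharacterModule (LinearMap.range τ) :=
    { toFun := fun y => χ (c y)
      map_zero' := hχ _ (by rw [hc']; rfl)
      map_add' := fun y₁ y₂ => by
        rw [← map_add]
        exact key _ _ (by rw [hc', smul_add, hc', hc']; rfl) }
  obtain ⟨ψ, hψ⟩ := CharacterModule.dual_surjective_of_injective (LinearMap.range τ).subtype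
    (LinearMap.range τ).injective_subtype ψ₀
  refine ⟨ψ, ?_⟩
  ext n
  have hn : r • n ∈ LinearMap.range τ := ⟨n, rfl⟩
  have h1 : ψ (r • n) = ψ₀ ⟨r • n, hn⟩ := by
    rw [← hψ]; rfl
  rw [CharacterModule.smul_apply, h1]
  exact key _ _ (hc' ⟨r • n, hn⟩)

variable {p : ℕ} [Fact p.Prime] {D : Type*} [AddCommGroup D] [Module ℤ_[p] D]

/-- **The Pontryagin dual of a `p`-primary `ℤ_p`-module with finite `p`-torsion is finitely
generated** (the module is "cofinitely generated"): `D^∨ = Hom(D, ℚ/ℤ)` is `p`-adically separated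
(every `d` is killed by some `pⁿ`, so `(pⁿ y)(d) = y(pⁿ d) = 0`), the restriction
`D^∨ → (D[p])^∨` has finite target and kernel `⊆ p·D^∨` (factor and extend), and the tree's
topological Nakayama over `ℤ_p` (`module_finite_of_separated_of_addMonoidHom_finite`) concludes.
[cite: Washington1997, Lemma 13.16 (Nakayama for compact ℤ_p / Λ-modules)]
[cite: GreenbergLNM1716, §4, proof of Prop. 4.10 (X/𝔪X finite ⇒ X finitely generated, for X a Pontryagin dual)] -/
theorem module_finite_characterModule_of_torsion_finite
    (hprim : ∀ d : D, ∃ n : ℕ, (p : ℤ_[p]) ^ n • d = 0)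
    (hfin : {d : D | (p : ℤ_[p]) • d = 0}.Finite) :
    Module.Finite ℤ_[p] (CharacterModule D) := by
  classical
  haveI : Finite (Submodule.torsionBy ℤ_[p] D (p : ℤ_[p])) :=
    Set.finite_coe_iff.mpr (hfin.subset fun d hd => (Submodule.mem_torsionBy_iff _ d).1 hd)
  haveI := finite_characterModule (Submodule.torsionBy ℤ_[p] D (p : ℤ_[p]))
  refine module_finite_of_separated_of_addMonoidHom_finite (fun x hx => ?_)
    (CharacterModule.dual (Submodule.torsionBy ℤ_[p] D (p : ℤ_[p])).subtype).toAddMonoidHom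
    (fun x hx => ?_)
  · ext d
    obtain ⟨n, hn⟩ := hprim d
    obtain ⟨y, rfl⟩ := hx n
    rw [CharacterModule.smul_apply, hn, map_zero]
    rfl
  · refine exists_smul_eq_of_forall_apply_eq_zero (p : ℤ_[p]) x fun d hd => ?_
    have h := DFunLike.congr_fun hx ⟨d, (Submodule.mem_torsionBy_iff _ d).2 hd⟩
    exact h

end Dual

/-! ### §2. The discharge -/

section Main

set_option maxHeartbeats 800000 in
/-- **Skinner–Urban 2014, Lemma 3.1.9 for `A = Λ = ℤ_p⟦T⟧` — PROVED**: for a number field `K`, a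
prime `p`, a `ℤ_p`-extension `κ`, a finite place `𝔮`, a FINITE set `Σ`, and a continuous `ℤ_p`-linear
`ρ : Γ_K → Aut(A₀)` on a discrete `p`-primary `A₀` with `A₀[p]` finite, unramified at every finite
`w ∉ Σ`, `w ∤ p`, the Pontryagin dual `XBig κ ρ 𝔮 Σ = Sel^Σ_𝔮(K, T ⊗ Λ^*)^∨` is a finitely generated
`Λ`-module (module docstring for the proof: compact Nakayama in separated form; (N1) from the
`(p,T)`-torsion of `H¹(Γ_K, T ⊗ Λ^*)`; (N2) from `X/TX ↪ Sel[T]^∨`, the lift of `Sel[T]` to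
`A₀`-valued cocycles unramified outside `Σ ∪ S_p`, and Hermite–Minkowski X.4.3). Discharges the named
fact `lemma319_finite_XBig` (statement untouched; its `p`-divisibility hypothesis is not used).
[cite: SkinnerUrban2014, Lemma 3.1.9 (p. 20) with §3.1.3 (p. 18)]
[cite: GreenbergLNM1716, §4, Props. 4.9–4.10 and the proposition cited by [SU14]]
[cite: Castella2018, Def. 2.2 (p. 4, "easily shown to be a finitely generated Λ-module")] -/
theorem lemma319_finite_XBig_holds : lemma319_finite_XBig := by
  intro K _ _ p _ κ 𝔮 S hS A₀ _ _ _ _ ρ hprim _hdiv hfin hunr _ _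
  classical
  -- ambient objects
  have hp0 : (p : ℕ) ≠ 0 := (Fact.out : p.Prime).ne_zero
  set ρM : ContinuousRep (absoluteGaloisGroup K) (IwasawaAlgebra p) (BigRepModule ℤ_[p] p A₀) :=
    AnticyclotomicBigGaloisRep κ ρ with hρM
  -- `p`-primary / `p`-torsion hypotheses in `ℤ_p`-currency
  have hprim' : ∀ a : A₀, ∃ n : ℕ, (p : ℤ_[p]) ^ n • a = 0 := fun a => by
    obtain ⟨j, hj⟩ := hprim a
    exact ⟨j, by rw [← Nat.cast_pow, Nat.cast_smul_eq_nsmul, hj]⟩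
  have hfin' : {a : A₀ | (p : ℤ_[p]) • a = 0}.Finite := by
    refine hfin.subset fun a ha => ?_
    rw [Set.mem_setOf_eq] at ha ⊢
    rwa [Nat.cast_smul_eq_nsmul] at ha
  -- `ℤ_p` acts continuously on the discrete `p`-primary `A₀` (annihilators are open)
  have hIopen : ∀ n : ℕ, IsOpen (Ideal.span {(p : ℤ_[p]) ^ n} : Set ℤ_[p]) := fun n => by
    have hball : (Ideal.span {(p : ℤ_[p]) ^ n} : Set ℤ_[p]) =
        Metric.closedBall (0 : ℤ_[p]) ((p : ℝ) ^ (-n : ℤ)) := by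
      ext x
      rw [SetLike.mem_coe, Metric.mem_closedBall, dist_zero_right,
        PadicInt.norm_le_pow_iff_mem_span_pow]
    rw [hball]
    exact IsUltrametricDist.isOpen_closedBall _ (zpow_ne_zero _ (by exact_mod_cast hp0))
  haveI : ContinuousSMul ℤ_[p] A₀ := by
    refine ⟨continuous_discrete_rng.mpr fun b => ?_⟩
    rw [isOpen_iff_forall_mem_open]
    rintro ⟨r, a⟩ hra
    obtain ⟨j, hj⟩ := hprim' a
    refine ⟨(fun q : ℤ_[p] × A₀ => q.1 - r) ⁻¹' (Ideal.span {(p : ℤ_[p]) ^ j} : Set ℤ_[p]) ∩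
      Prod.snd ⁻¹' {a}, ?_, ?_, ?_⟩
    · rintro ⟨r', a'⟩ ⟨hr', ha'⟩
      rw [Set.mem_preimage, Set.mem_singleton_iff] at ha'
      subst ha'
      rw [Set.mem_preimage, SetLike.mem_coe, Ideal.mem_span_singleton'] at hr'
      obtain ⟨t, ht⟩ := hr'
      rw [Set.mem_preimage, Set.mem_singleton_iff] at hra ⊢
      rw [← hra, ← sub_eq_zero, ← sub_smul, ← ht, mul_smul, hj, smul_zero]
    · exact ((hIopen j).preimage (continuous_fst.sub continuous_const)).inter
        ((isOpen_discrete {a}).preimage continuous_snd)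
    · refine ⟨?_, rfl⟩
      rw [Set.mem_preimage, sub_self]
      exact Submodule.zero_mem _
  -- the inertia groups `I_w`, `w ∉ Σ`, `w ∤ p`, act trivially on `M = T ⊗ Λ^*`
  have hI : ∀ w : HeightOneSpectrum (𝓞 K), w ∉ S → ((p : ℕ) : 𝓞 K) ∉ w.asIdeal →
      ∀ (σ : LocalGroup K (Sum.inr w)) (Φ : BigRepModule ℤ_[p] p A₀),
        ρM (localMap K (Sum.inr w) σ) Φ = Φ := by
    intro w hw hwp σ Φ
    refine BigRepModule.ext fun x => ?_
    rw [hρM]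
    change bigRep κ.toContinuousMonoidHom ρ (localMap K (Sum.inr w) σ) Φ x = Φ x
    rw [bigRep_apply_apply, ZpExtension.coe_toContinuousMonoidHom,
      ZpExtension.apply_localMap_inr κ hwp σ, toAdd_one, sub_zero, hunr w hw hwp σ]
  -- constant functions
  have hconst : ∀ a : A₀, (fun _ : ℤ_[p] => a) ∈ bigRepSubmodule ℤ_[p] p A₀ := fun a =>
    (BigRepModule.const_mem_bigRepSubmodule_iff a).2 (hprim a)
  -- (N1) separatedness of `X = Sel^∨`
  have hsep : ∀ x : XBig κ ρ 𝔮 S, (∀ k : ℕ, ∃ y z : XBig κ ρ 𝔮 S,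
      (PowerSeries.X : IwasawaAlgebra p) ^ k • y + PowerSeries.C ((p : ℤ_[p]) ^ k) • z = x) →
      x = 0 := by
    intro x hx
    ext c
    obtain ⟨n, hT, hP⟩ := exists_pow_smul_eq_zero_and ρM.toTopRep (PowerSeries.X : IwasawaAlgebra p)
      (PowerSeries.C (p : ℤ_[p]) : IwasawaAlgebra p) BigRepModule.exists_X_pow_smul_eq_zero
      BigRepModule.exists_C_natCast_pow_smul_eq_zero (c : continuousCohomology 1 ρM.toTopRep)
    obtain ⟨y, z, rfl⟩ := hx n
    have h1 : (PowerSeries.X : IwasawaAlgebra p) ^ n • c = 0 :=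
      Subtype.ext (by rw [Submodule.coe_smul, hT, Submodule.coe_zero])
    have h2 : PowerSeries.C ((p : ℤ_[p]) ^ n) • c = 0 :=
      Subtype.ext (by rw [Submodule.coe_smul, map_pow, hP, Submodule.coe_zero])
    change ((PowerSeries.X : IwasawaAlgebra p) ^ n • y) c + (PowerSeries.C ((p : ℤ_[p]) ^ n) • z) c = 0
    rw [CharacterModule.smul_apply, CharacterModule.smul_apply, h1, h2, map_zero, map_zero, add_zero]
  -- pointwise bookkeeping on characters and cocycles
  have hXadd : ∀ (y z : XBig κ ρ 𝔮 S) (c : selmerBig κ ρ 𝔮 S), (y + z) c = y c + z c :=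
    fun _ _ _ => rfl
  have hXsub : ∀ (y z : XBig κ ρ 𝔮 S) (c : selmerBig κ ρ 𝔮 S), (y - z) c = y c - z c :=
    fun _ _ _ => rfl
  have hzext : ∀ z z' : contOneCocycles ρM.toTopRep, (∀ g x, z.1 g x = z'.1 g x) → z = z' :=
    fun z z' h => Subtype.ext (ContinuousMap.ext fun g => BigRepModule.ext (h g))
  have hvadd : ∀ (z z' : contOneCocycles ρM.toTopRep) (g : absoluteGaloisGroup K) (x : ℤ_[p]),
      (z + z').1 g x = z.1 g x + z'.1 g x := fun z z' g x => by
    rw [Submodule.coe_add, ContinuousMap.add_apply, BigRepModule.add_apply]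
  have hvsmul : ∀ (a : ℤ_[p]) (z : contOneCocycles ρM.toTopRep) (g : absoluteGaloisGroup K)
      (x : ℤ_[p]), ((PowerSeries.C a : IwasawaAlgebra p) • z).1 g x = a • z.1 g x := by
    intro a z g x
    rw [contOneCocycles.smul_apply]
    change ((PowerSeries.C a : PowerSeries ℤ_[p]) • z.1 g) x = _
    rw [BigRepModule.C_smul, BigRepModule.smul_apply]
  -- the `G`-action on constant functions is `ρ`
  have hιρ : ∀ (g : absoluteGaloisGroup K) (a : A₀),
      ρM g (BigRepModule.mk (fun _ : ℤ_[p] => a) (hconst a)) =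
        BigRepModule.mk (fun _ : ℤ_[p] => ρ g a) (hconst (ρ g a)) := by
    intro g a
    rw [hρM]
    exact BigRepModule.bigRep_mk_const κ.toContinuousMonoidHom ρ g a (hconst a)
  -- (b1) the constant embedding of `A₀`-cocycles into `M`-cocycles
  have hcz : ∀ φ : contOneCocycles ρ.toTopRep, ∃ z : contOneCocycles ρM.toTopRep,
      ∀ g x, z.1 g x = φ.1 g := by
    intro φ
    refine ⟨⟨⟨fun g => BigRepModule.mk (fun _ : ℤ_[p] => φ.1 g) (hconst (φ.1 g)), ?_⟩,
      fun g h => ?_⟩, fun g x => rfl⟩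
    · exact (continuous_of_discreteTopology
        (f := fun a : A₀ => BigRepModule.mk (fun _ : ℤ_[p] => a) (hconst a))).comp φ.1.continuous
    · have e : φ.1 (g * h) = φ.1 g + ρ g (φ.1 h) := φ.2 g h
      change BigRepModule.mk (fun _ : ℤ_[p] => φ.1 (g * h)) (hconst _) =
        BigRepModule.mk (fun _ : ℤ_[p] => φ.1 g) (hconst _) +
          ρM g (BigRepModule.mk (fun _ : ℤ_[p] => φ.1 h) (hconst _))
      rw [hιρ]
      exact BigRepModule.ext fun x => by
        rw [BigRepModule.mk_apply, BigRepModule.add_apply, BigRepModule.mk_apply,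
          BigRepModule.mk_apply, e]
  -- (b2) the lift: a class of `Sel` killed by `T` is `[ι ∘ φ]` for an `A₀`-cocycle `φ` vanishing on
  -- the inertia groups `I_w`, `w ∉ Σ`, `w ∤ p`
  have hlift : ∀ c : continuousCohomology 1 ρM.toTopRep, c ∈ selmerBig κ ρ 𝔮 S →
      (PowerSeries.X : IwasawaAlgebra p) • c = 0 →
      ∃ (φ : contOneCocycles ρ.toTopRep) (z : contOneCocycles ρM.toTopRep),
        (∀ g x, z.1 g x = φ.1 g) ∧ oneCocycleClass ρM.toTopRep z = c ∧
        ∀ w : HeightOneSpectrum (𝓞 K), w ∉ S → ((p : ℕ) : 𝓞 K) ∉ w.asIdeal →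
          ∀ σ : LocalGroup K (Sum.inr w), φ.1 (localMap K (Sum.inr w) σ) = 0 := by
    intro c hc hTc
    have hsurj : Function.Surjective fun m : ρM.toTopRep => (PowerSeries.X : IwasawaAlgebra p) • m := by
      intro m
      obtain ⟨m', hm'⟩ := BigRepModule.shiftSubOne_surjective (𝒪 := ℤ_[p]) (p := p) (A := A₀) m
      refine ⟨m', ?_⟩
      change (PowerSeries.X : PowerSeries ℤ_[p]) • m' = m
      rw [BigRepModule.X_smul]
      exact hm'
    obtain ⟨z, hzc, hzT⟩ := exists_oneCocycleClass_eq_forall_smul_apply_eq_zero ρM.toTopRep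
      (continuous_toTopRep_ρ_apply ρM) _ hsurj c hTc
    have hzconst : ∀ g x, z.1 g x = z.1 g 0 := fun g =>
      (BigRepModule.X_smul_eq_zero_iff (z.1 g)).1 (hzT g)
    refine ⟨⟨⟨fun g => z.1 g 0, ?_⟩, fun g h => ?_⟩, z, fun g x => hzconst g x, hzc,
      fun w hw hwp σ => ?_⟩
    · exact (continuous_of_discreteTopology
        (f := fun Φ : BigRepModule ℤ_[p] p A₀ => Φ 0)).comp z.1.continuous
    · have e := congrArg (fun Φ : BigRepModule ℤ_[p] p A₀ => Φ 0) (z.2 g h)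
      change z.1 (g * h) 0 = z.1 g 0 + ρ g (z.1 h 0)
      refine e.trans ?_
      change (z.1 g + ρM g (z.1 h)) 0 = _
      rw [BigRepModule.add_apply]
      change z.1 g 0 + bigRep κ.toContinuousMonoidHom ρ g (z.1 h) 0 = _
      rw [bigRep_apply_apply, hzconst h]
    · have hres : resH1 ρM (localMap K (Sum.inr w)) (oneCocycleClass ρM.toTopRep z) = 0 := by
        rw [hzc]
        exact ((mem_selmerBig_iff κ ρ 𝔮 S c).1 hc).2 w hw hwp
      have h0 := apply_eq_zero_of_resH1_eq_zero ρM (localMap K (Sum.inr w)) (hI w hw hwp) z hres σ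
      change z.1 (localMap K (Sum.inr w) σ) 0 = 0
      rw [h0, BigRepModule.zero_apply]
  -- (c1) the `ℤ_p`-module `U` of `A₀`-cocycles vanishing on those inertia groups whose constant
  -- embedding has class in `Sel`
  obtain ⟨U, hU⟩ : ∃ U : Submodule ℤ_[p] (contOneCocycles ρ.toTopRep),
      ∀ φ, φ ∈ U ↔ (∀ w : HeightOneSpectrum (𝓞 K), w ∉ S → ((p : ℕ) : 𝓞 K) ∉ w.asIdeal →
        ∀ σ : LocalGroup K (Sum.inr w), φ.1 (localMap K (Sum.inr w) σ) = 0) ∧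
        ∀ z : contOneCocycles ρM.toTopRep, (∀ g x, z.1 g x = φ.1 g) →
          oneCocycleClass ρM.toTopRep z ∈ selmerBig κ ρ 𝔮 S := by
    refine ⟨{ carrier := {φ | (∀ w : HeightOneSpectrum (𝓞 K), w ∉ S → ((p : ℕ) : 𝓞 K) ∉ w.asIdeal →
                  ∀ σ : LocalGroup K (Sum.inr w), φ.1 (localMap K (Sum.inr w) σ) = 0) ∧
                  ∀ z : contOneCocycles ρM.toTopRep, (∀ g x, z.1 g x = φ.1 g) →
                    oneCocycleClass ρM.toTopRep z ∈ selmerBig κ ρ 𝔮 S},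
              add_mem' := fun {a b} ha hb => ⟨fun w hw hwp σ => ?_, fun z hz => ?_⟩,
              zero_mem' := ⟨fun _ _ _ _ => rfl, fun z hz => ?_⟩,
              smul_mem' := fun r a ha => ⟨fun w hw hwp σ => ?_, fun z hz => ?_⟩ }, fun _ => Iff.rfl⟩
    · change (a + b).1 _ = 0
      rw [Submodule.coe_add, ContinuousMap.add_apply, ha.1 w hw hwp σ, hb.1 w hw hwp σ, add_zero]
    · obtain ⟨za, hza⟩ := hcz a
      obtain ⟨zb, hzb⟩ := hcz b
      have hz' : z = za + zb := hzext _ _ fun g x => by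
        rw [hz, hvadd, hza, hzb, Submodule.coe_add, ContinuousMap.add_apply]
      rw [hz', oneCocycleClass_add]
      exact Submodule.add_mem _ (ha.2 za hza) (hb.2 zb hzb)
    · have hz' : z = 0 := hzext _ _ fun g x => by rw [hz]; rfl
      rw [hz', oneCocycleClass_zero]
      exact Submodule.zero_mem _
    · change (r • a).1 _ = 0
      rw [Submodule.coe_smul, ContinuousMap.smul_apply, ha.1 w hw hwp σ, smul_zero]
    · obtain ⟨za, hza⟩ := hcz a
      have hz' : z = (PowerSeries.C r : IwasawaAlgebra p) • za := hzext _ _ fun g x => by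
        rw [hz, hvsmul, hza, Submodule.coe_smul, ContinuousMap.smul_apply]
      rw [hz', oneCocycleClass_smul]
      exact Submodule.smul_mem _ _ (ha.2 za hza)
  -- (c2) `π : U → Sel`, `φ ↦ [ι ∘ φ]`, additive and `ℤ_p → Λ`-semilinear
  have hπex : ∀ φ : U, ∃ c : selmerBig κ ρ 𝔮 S, ∀ z : contOneCocycles ρM.toTopRep,
      (∀ g x, z.1 g x = φ.1.1 g) → oneCocycleClass ρM.toTopRep z = c := by
    intro φ
    obtain ⟨z, hz⟩ := hcz φ.1
    refine ⟨⟨_, ((hU φ.1).1 φ.2).2 z hz⟩, fun z' hz' => ?_⟩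
    rw [hzext z' z fun g x => by rw [hz', hz]]
  choose π hπ using hπex
  have hπadd : ∀ φ ψ : U, π (φ + ψ) = π φ + π ψ := by
    intro φ ψ
    obtain ⟨z, hz⟩ := hcz φ.1
    obtain ⟨z', hz'⟩ := hcz ψ.1
    apply Subtype.ext
    rw [Submodule.coe_add, ← hπ φ z hz, ← hπ ψ z' hz', ← oneCocycleClass_add]
    refine (hπ (φ + ψ) (z + z') fun g x => ?_).symm
    rw [hvadd, hz, hz']
    rfl
  have hπsmul : ∀ (a : ℤ_[p]) (φ : U), π (a • φ) = (PowerSeries.C a : IwasawaAlgebra p) • π φ := by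
    intro a φ
    obtain ⟨z, hz⟩ := hcz φ.1
    apply Subtype.ext
    rw [Submodule.coe_smul, ← hπ φ z hz, ← oneCocycleClass_smul]
    refine (hπ (a • φ) _ fun g x => ?_).symm
    rw [hvsmul, hz]
    rfl
  -- (c3) `Θ : X → U^∨`, `x ↦ x ∘ π`, and its image `W`, a `ℤ_p`-submodule
  have hΘex : ∀ x : XBig κ ρ 𝔮 S, ∃ θ : CharacterModule U, ∀ φ, θ φ = x (π φ) := fun x =>
    ⟨(x : selmerBig κ ρ 𝔮 S →+ AddCircle (1 : ℚ)).comp (AddMonoidHom.mk' π hπadd), fun _ => rfl⟩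
  choose Θ hΘ using hΘex
  have hΘadd : ∀ x x' : XBig κ ρ 𝔮 S, Θ (x + x') = Θ x + Θ x' := fun x x' => by
    ext φ
    change Θ (x + x') φ = Θ x φ + Θ x' φ
    rw [hΘ, hΘ, hΘ, hXadd]
  have hΘsmul : ∀ (a : ℤ_[p]) (x : XBig κ ρ 𝔮 S),
      Θ ((PowerSeries.C a : IwasawaAlgebra p) • x) = a • Θ x := fun a x => by
    ext φ
    rw [hΘ, CharacterModule.smul_apply, CharacterModule.smul_apply, hΘ, hπsmul]
  obtain ⟨W, hW⟩ : ∃ W : Submodule ℤ_[p] (CharacterModule U), ∀ θ, θ ∈ W ↔ ∃ x, Θ x = θ :=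
    ⟨{ carrier := Set.range Θ,
       add_mem' := by
         rintro _ _ ⟨x, rfl⟩ ⟨x', rfl⟩
         exact ⟨x + x', hΘadd x x'⟩,
       zero_mem' := ⟨0, by
         ext φ
         rw [hΘ]
         rfl⟩,
       smul_mem' := by
         rintro a _ ⟨x, rfl⟩
         exact ⟨(PowerSeries.C a : IwasawaAlgebra p) • x, hΘsmul a x⟩ }, fun _ => Iff.rfl⟩
  -- (c4) `U^∨`, hence `W`, is finitely generated over `ℤ_p` (`U` is `p`-primary with finite
  -- `p`-torsion: Silverman X.4.3 on the `A₀[p]`-valued cocycles unramified outside `Σ ∪ S_p`)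
  have hUfg : Module.Finite ℤ_[p] (CharacterModule U) := by
    refine module_finite_characterModule_of_torsion_finite (p := p) (fun d => ?_) ?_
    · obtain ⟨n, hn⟩ :=
        contOneCocycles.exists_pow_smul_apply_eq_zero ρ.toTopRep (p : ℤ_[p]) hprim' d.1
      exact ⟨n, Subtype.ext (by
        rw [Submodule.coe_smul, Submodule.coe_zero]
        exact contOneCocycles.smul_eq_zero_of_forall ρ.toTopRep _ d.1 hn)⟩
    · have hF := finite_setOf_contOneCocycles_smul_eq_zero_vanishing_inertia ρ (p : ℤ_[p]) hfin'
        (hS.union (finite_setOf_natCast_mem_asIdeal (K := K) hp0))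
      refine Set.Finite.of_finite_image (f := fun d : U => (d : contOneCocycles ρ.toTopRep))
        (hF.subset ?_) Subtype.val_injective.injOn
      rintro _ ⟨d, hd, rfl⟩
      have hd' : (p : ℤ_[p]) • (d : contOneCocycles ρ.toTopRep) = 0 := by
        rw [← Submodule.coe_smul, (hd : (p : ℤ_[p]) • d = 0), Submodule.coe_zero]
      refine ⟨fun g => ?_, fun w hw σ => ?_⟩
      · rw [← contOneCocycles.smul_apply, hd']
        rfl
      · exact ((hU d.1).1 d.2).1 w (fun h => hw (Or.inl h)) (fun h => hw (Or.inr h)) σ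
  have hWfg : W.FG := by
    haveI : IsNoetherian ℤ_[p] (CharacterModule U) := isNoetherian_of_isNoetherianRing_of_finite _ _
    exact IsNoetherian.noetherian W
  obtain ⟨t, ht⟩ := hWfg
  have htW : ∀ θ ∈ t, ∃ x, Θ x = θ := fun θ hθ => (hW θ).1 (ht ▸ Submodule.subset_span hθ)
  choose! xOf hxOf using htW
  -- (N2) `X = ⟨xOf t⟩_Λ + T·X`
  have hgen : ∀ x : XBig κ ρ 𝔮 S, ∃ y : XBig κ ρ 𝔮 S,
      x - (PowerSeries.X : IwasawaAlgebra p) • y ∈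
        Submodule.span (IwasawaAlgebra p)
          ((t.image xOf : Finset (XBig κ ρ 𝔮 S)) : Set (XBig κ ρ 𝔮 S)) := by
    intro x
    have hxW : Θ x ∈ Submodule.span ℤ_[p] (t : Set (CharacterModule U)) := by
      rw [ht]; exact (hW _).2 ⟨x, rfl⟩
    obtain ⟨f, -, hf⟩ := Submodule.mem_span_finset.1 hxW
    -- the lift `x₀ = Σ C(f θ) • xOf θ ∈ ⟨xOf t⟩_Λ` with `Θ x₀ = Θ x`
    have hx₀mem : (∑ θ ∈ t, (PowerSeries.C (f θ) : IwasawaAlgebra p) • xOf θ) ∈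
        Submodule.span (IwasawaAlgebra p)
          ((t.image xOf : Finset (XBig κ ρ 𝔮 S)) : Set (XBig κ ρ 𝔮 S)) :=
      Submodule.sum_mem _ fun θ hθ => Submodule.smul_mem _ _ (Submodule.subset_span (by
        rw [Finset.coe_image]; exact Set.mem_image_of_mem xOf hθ))
    have hΘx₀ : Θ (∑ θ ∈ t, (PowerSeries.C (f θ) : IwasawaAlgebra p) • xOf θ) = Θ x := by
      rw [← hf]
      change (AddMonoidHom.mk' Θ hΘadd) (∑ θ ∈ t, (PowerSeries.C (f θ) : IwasawaAlgebra p) • xOf θ) = _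
      rw [map_sum]
      refine Finset.sum_congr rfl fun θ hθ => ?_
      change Θ _ = _
      rw [hΘsmul, hxOf θ hθ]
    -- `x - x₀` kills `π(U) ⊇ Sel[T]`, hence is `T • y`
    have hkill : ∀ c : selmerBig κ ρ 𝔮 S, (PowerSeries.X : IwasawaAlgebra p) • c = 0 →
        (x - ∑ θ ∈ t, (PowerSeries.C (f θ) : IwasawaAlgebra p) • xOf θ) c = 0 := by
      intro c hc
      obtain ⟨φ, z, hzφ, hzc, hφv⟩ := hlift c.1 c.2 (by
        rw [← Submodule.coe_smul, hc, Submodule.coe_zero])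
      have hφU : φ ∈ U := (hU φ).2 ⟨hφv, fun z' hz' => by
        rw [hzext z' z fun g x => by rw [hz', hzφ], hzc]; exact c.2⟩
      have hπc : π ⟨φ, hφU⟩ = c := Subtype.ext (by rw [← hπ ⟨φ, hφU⟩ z hzφ, hzc])
      have e := congrArg (fun θ : CharacterModule U => θ ⟨φ, hφU⟩) hΘx₀
      simp only [hΘ, hπc] at e
      rw [hXsub, e, sub_self]
    obtain ⟨y, hy⟩ :=
      exists_smul_eq_of_forall_apply_eq_zero (PowerSeries.X : IwasawaAlgebra p) _ hkill
    exact ⟨y, by rw [hy, sub_sub_cancel]; exact hx₀mem⟩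
  exact module_finite_of_separated_of_forall_exists_sub_X_smul_mem_span hsep (t.image xOf) hgen

/-! ### §3. Unconditional corollaries (appended 2026-08-27, same seat): general coefficients `𝒪`,
and the members `A_g` of a `p`-adically embedded newform -/

/-- **Lemma 3.1.9 for a general coefficient ring `𝒪` (a commutative `ℤ_p`-algebra) — PROVED**:
for `ρ : Γ_K → Aut_𝒪(A)` continuous on a discrete `A` that is `p`-primary, `p`-divisible with `A[p]`
finite and unramified at every finite `w ∉ Σ`, `w ∤ p` (`Σ` finite), the dual Selmer group
`XBig κ ρ 𝔮 Σ = Sel^Σ_𝔮(K, T ⊗ Λ_𝒪^*)^∨` is a finitely generated `𝒪⟦T⟧`-module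
(`moduleFinite_XBig_of_lemma319` fed with `lemma319_finite_XBig_holds`).
[cite: SkinnerUrban2014, Lemma 3.1.9 (p. 20, "the dual Selmer groups `X^Σ_F(T, (T_v)_{v∣p})` … are finitely generated over `A`")] -/
theorem moduleFinite_XBig {K : Type} [Field K] [NumberField K] {p : ℕ} [Fact p.Prime]
    (κ : ZpExtension K p) (𝔮 : HeightOneSpectrum (𝓞 K)) (S : Set (HeightOneSpectrum (𝓞 K)))
    (hS : S.Finite) {𝒪 : Type} [CommRing 𝒪] [Algebra ℤ_[p] 𝒪] [TopologicalSpace 𝒪]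
    {A : Type} [AddCommGroup A] [Module 𝒪 A] [TopologicalSpace A] [DiscreteTopology A]
    (ρ : ContinuousRep (absoluteGaloisGroup K) 𝒪 A)
    (hprim : ∀ a : A, ∃ j : ℕ, p ^ j • a = 0) (hdiv : ∀ a : A, ∃ b : A, p • b = a)
    (hfin : {a : A | p • a = 0}.Finite)
    (hunr : ∀ w : HeightOneSpectrum (𝓞 K), w ∉ S → ((p : ℕ) : 𝓞 K) ∉ w.asIdeal →
      ∀ (σ : LocalGroup K (Sum.inr w)) (a : A), ρ (localMap K (Sum.inr w) σ) a = a)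
    [TopologicalSpace (PowerSeries 𝒪)] [ContinuousSMul (PowerSeries 𝒪) (BigRepModule 𝒪 p A)] :
    Module.Finite (PowerSeries 𝒪) (XBig κ ρ 𝔮 S) :=
  moduleFinite_XBig_of_lemma319 lemma319_finite_XBig_holds κ 𝔮 S hS ρ hprim hdiv hfin hunr

open Literature.NumberTheory.EllipticCurves.GreenbergSelmer
  Literature.NumberTheory.EllipticCurves.ModularForms in
/-- **Lemma 3.1.9 for the members `A_g` — PROVED, unconditionally**: for a cusp form
`g ∈ S_k(Γ₀(N))` with a `p`-adic embedding `ι` of finite-degree coefficient field, an integral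
ordinary datum `Δ`, a number field `K`, a `ℤ_p`-extension `κ`, a finite place `𝔮` and a FINITE set
`Σ` containing every place dividing `N`, `X^Σ_ac(A_g) = XBig κ (Δ.cofreeRepOver K) 𝔮 Σ` is a finitely
generated `Λ_𝒪 = 𝒪⟦T⟧`-module, `𝒪 = padicCoeffIntegers ι` (the `∀`-body of
`lemma319_finite_XBig_newform_of_lemma319`, fed with `lemma319_finite_XBig_holds`).
[cite: SkinnerUrban2014, Lemma 3.1.9 (p. 20) with §3.1.3 (p. 18)]
[cite: Castella2018Erratum, §2 and Thm. 2.3 (pp. 2–3, "`X^Σ_ac(A_g) = Sel^Σ_𝔭(K, M_g)^*`")] -/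
theorem moduleFinite_XBig_newform {N : ℕ} {k : ℤ} {g : CuspForm (CongruenceSubgroup.Gamma0 N) k}
    {p : ℕ} [Fact p.Prime] {ι : coeffField g →+* PadicAlgCl p} (Δ : OrdinaryNewformDatum g p ι)
    (hfd : FiniteDimensional ℚ_[p] (padicCoeffField ι))
    (K : Type) [Field K] [NumberField K] (κ : ZpExtension K p) (𝔮 : HeightOneSpectrum (𝓞 K))
    (S : Set (HeightOneSpectrum (𝓞 K))) (hS : S.Finite)
    (hSN : ∀ w : HeightOneSpectrum (𝓞 K), w ∉ S → ((N : ℕ) : 𝓞 K) ∉ w.asIdeal)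
    [TopologicalSpace (PowerSeries (padicCoeffIntegers ι))]
    [ContinuousSMul (PowerSeries (padicCoeffIntegers ι))
      (BigRepModule (padicCoeffIntegers ι) p (Cofree Δ.ρ (padicCoeffField ι)))] :
    Module.Finite (PowerSeries (padicCoeffIntegers ι)) (XBig κ (Δ.cofreeRepOver K) 𝔮 S) :=
  lemma319_finite_XBig_newform_of_lemma319 lemma319_finite_XBig_holds Δ hfd K κ 𝔮 S hS hSN

end Main

end Literature.NumberTheory.EllipticCurves.SkinnerUrban2014

end
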